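import Summits.QuantumFields.BalabanUV.Beta.D1BFx.RestLegEnvelopes
import Summits.QuantumFields.BalabanUV.Beta.D1BFx.RestLegContourSum
import Summits.QuantumFields.BalabanUV.Beta.D1BFx.NlegKHessSplit

/-!
# `BalabanUV.Beta.D1BFx.RestLegSandwich` — road «BF-x» for binder row D1, slot (K), DICT-CHAIN-SPEC §2 (II) row RK-SAND: **«SAND-ENV» — THE SANDWICH LEG
# `Ga𝒬ᵀCun′𝒬Ga = ℋ_R ∘ 𝒬 ∘ Ga` IS SMOOTH AT SCALE `n`**: its ff block obeys `|sandP (x, x′)| ≤ n⁻²·K·e^{−(c∕n)|x − x′|₁}` with n-free `K, c`, modulo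
# [B5, Prop. 1.2] ∧ [B5, (1.126)–(1.127)] BY NAME (the fine leg's profile and the `ℋ_R` read-out) — the OWNER's heuristic «`≲ n⁻²·e^{−c|x−y|∕n}`» as a theorem

HONEST DEPENDENCY (cell records, verbatim): «continuum YM on T⁴ ⇐ BetaPertH ∧ nine spine estimates (0/9 proved); BetaPertH ⇐ (D1) ∧ (D4) ∧
CAP+tail; G-an2-4 gates asym, D1 and NE2/3/4.»  HONEST FRAMING (cell contract, verbatim): «discharging `BetaPertH` makes Bałaban's UV stability
UNCONDITIONAL — a real constructive-QFT result; it is NOT the continuum limit and NOT the Clay problem.»  THIS MODULE DISCHARGES NOTHING of the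
wall: [folklore] lattice bookkeeping BY NAME — FILE 1 `RestLegContourSum` (the `𝒬`-leg: `comp_Qp_Gp_inr_inl`, `exists_contourSum_Ga_le`, n³; the two printed
[B5] statements enter ONLY through its profile letter and the `ℋ_R` read-out, as hypotheses `h12 ∧ h126`, never proved), this lineage's
`RestLegEnvelopes.abs_NlegRoad_inl_inr_coarse_le` (the `ℋ_R` column, n⁻⁵), ne9-leaf-06's `RWeightedLegPack*` plumbing (`NlegK_inl_inr_eq_HRp`,
`zsmul_injective`), `NlegKHessSplit.HRp_inl_inl`, an2's `ExpKernelCalculus` (`Zl`, `tsum_exp_shift`, `l1_sub_triangle`), Mathlib's `tsum_of_norm_bounded`.  No definition, no `def … : Prop`,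
nothing cited, 0 sorry.  NO (1.22) row is proved (RK-SAND's four word counts remain OPEN); this is their `B`-leg letter with n-explicit constants.
0 root-level binders of row D1 discharged; (K) NOT closed; NOT D1, NOT `BetaPertH`, NOT continuum, NOT Clay.

ABSOLUTE RULE (cell charter, verbatim): «No internally-minted statement may enter as a cited fact. Every hypothesis is either kernel-proved in
this package or a verbatim quotation of a PUBLISHED theorem with page reference. The manuscript(s) under audit are NOT citable for their own
disputed steps — they are the thing under adjudication; programme-internal (2001/route/tribunal) claims are never citable.»

WHY (`HOME/b2b-balaban-beta-d1-p2/DICT-CHAIN-SPEC.md` v1.2 §2 row RK-SAND; OWNER W-d1p2-g15-7 (2) «RK-SAND after leaf-01's SAND-ENV»).  The 1 + 3 sandwich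
cross words of `RestKernelWords.crossWord (½•Ga) ((−½)•sandP_ff) V W` carry the leg `B := sandP_ff`; their unit-class rows need its n-uniform envelope.
`sandP = HRp ∘ (Qp ∘ Gp)`: the fm column of `HRp` is `wH^{(n)}` (n⁻⁵, block-scale decay — `RestLegEnvelopes`), the multiplier rows of `Qp` ARE `bhK`'s, so
`(Qp ∘ Gp Ga)(n•y₀; x′)` is the UNNORMALISED straight-contour sum of `Ga`'s column over the n⁵ legs of the block `y₀` (§1, exact), which the profile
`kG·e^{−(δ∕n)‖·‖∞}∕nrm²` sums to `n·n² = n³` (§2); the coarse-column sum then gives `n⁻⁵·n³ = n⁻²` with decay at scale `n` (§3).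

CONTENT (`n = m + 1`; FILE 2∕2 — FILE 1 `RestLegContourSum` has the `𝒬`-leg: `comp_Qp_Gp_inr_inl`, `exists_contourSum_Ga_le`).
* [folklore] `l1_le_four_mul_supNormP`; [mod `h12 ∧ h126`] **`exists_sandP_ff_le`** («SAND-ENV»: `∃ K c, 0 < c ∧ 0 ≤ K ∧ ∀ m x x′ κ κ′,
  |sandP n (Ga n a) (multM n (2a∕n⁸) 2) x x′ (inl κ) (inl κ′)| ≤ (n²)⁻¹·K·e^{−(c∕n)|x − x′|₁}`), **`exists_decays_blk_sandP_road`**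
  (`Decays (blk (sandP …) true true) (K∕n²) (c∕n)` for every `m` — the `B`-leg letter of `RestKernelWords.absMoment₂_crossWord_NlegRoad`).
Unit `b2b-balaban-beta-d1-formalise-leaf-01` (gen 20), D1 formalisation swarm leaf prover 01, road «BF-x»; INTENT 3 «SAND-ENV» (journal), FILE 2∕2.
-/

noncomputable section

open Finset
open scoped BigOperators
open Literature.Probability.LatticeModels (Torus.proj)
open Literature.MathematicalPhysics.QuantumFieldTheory.LatticeForm (quo)
open Literature.MathematicalPhysics.QuantumFieldTheory.Balaban1983to89
open Literature.MathematicalPhysics.QuantumFieldTheory.Balaban1983to89.Beta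
open B12Sec2to5 (l1 l1_nonneg)
open AffineAveraging (contourSum)
open ExpKernelCalculus (Site MKer Decays comp Zl Zl_pos tsum_exp_shift summable_exp_shift l1_sub_symm l1_sub_triangle)
open DyadicShell (Pt)
open PoissonInterior (supNorm)
open KernelSpecInstance (l1_le_l1_quo)
open OneStepResolventKernel (Fib eq_zsmul_quo_of_proj quo_zsmul proj_zsmul)
open VectorTailsLoc (fam kfam)
open Summit.QuantumFields.BalabanUV.Beta.TameKernelCalculus (Spr)
open Summit.QuantumFields.BalabanUV.Beta.D1BFx.PackedKernelSplit (blk)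
open Summit.QuantumFields.BalabanUV.Beta.D1BFx.CoarseGramInverse (multM spr_multM)
open Summit.QuantumFields.BalabanUV.Beta.D1BFx.RWeightedLegPack (Gp Qp Cp HRp sandP NlegK NlegRoad Gp_inl_inl Gp_inr_inl Qp_inr_inl Qp_inr_inr
  NlegK_inl_inr_eq_HRp NlegK_inr_col_off zsmul_injective)
open Summit.QuantumFields.BalabanUV.Beta.D1BFx.NlegKHessSplit (HRp_inl_inl)
open Summit.QuantumFields.BalabanUV.Beta.D1BFx.GluonLeg (Ga)
open Summit.QuantumFields.BalabanUV.Beta.D1BFx.RestLegContourSum (comp_Qp_Gp_inr_inl exists_contourSum_Ga_le)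
open Summit.QuantumFields.BalabanUV.Beta.D1BFx.FrozenLegTails (nOf MOf hn1)
open Summit.QuantumFields.BalabanUV.Beta.D1BFx.RestLegEnvelopes (abs_NlegRoad_inl_inr_le abs_NlegRoad_inl_inr_coarse_le)
open Summit.QuantumFields.BalabanUV.Beta.FP.PeriodicTransportSum (quotOf)
open BlochFibreUniqueness (quo_add_zsmul)
open B5Hk163Strip (kappa163 kappa163_pos)
open B5Hk163Decay (MG163)
open B4TorusKernel (periodConst)

namespace Summit.QuantumFields.BalabanUV.Beta.D1BFx.RestLegSandwich

/-! ## §3 «SAND-ENV»: the ff block of the sandwich leg is `O(n⁻²)` with scale-`n` decay (mod `h12 ∧ h126`) -/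

section Aux

/-- [folklore] `|v|₁ ≤ 4·‖v‖∞` on `ℤ⁴` for the integer sup-norm of `PoissonInterior`. -/
theorem l1_le_four_mul_supNormP (v : Fin 4 → ℤ) : l1 v ≤ 4 * (supNorm (d := 4) v : ℝ) := by
  unfold B12Sec2to5.l1
  have h : ∀ μ : Fin 4, |((v μ : ℤ) : ℝ)| ≤ (supNorm (d := 4) v : ℝ) := by
    intro μ
    rw [← Int.cast_abs, ← Nat.cast_natAbs]
    exact_mod_cast PoissonInterior.natAbs_le_supNorm v μ
  calc ∑ μ : Fin 4, |((v μ : ℤ) : ℝ)| ≤ ∑ _μ : Fin 4, (supNorm (d := 4) v : ℝ) := Finset.sum_le_sum fun μ _ => h μ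
    _ = 4 * (supNorm (d := 4) v : ℝ) := by rw [Finset.sum_const, Finset.card_univ, Fintype.card_fin, nsmul_eq_mul]; norm_num

end Aux

section Sandwich

variable {a : ℝ} (ha : 0 < a)
include ha

/-- [folklore] **«SAND-ENV» — THE SANDWICH LEG IS SMOOTH AT SCALE `n`**, modulo [B5, Prop. 1.2] ∧ [B5, (1.126)–(1.127)] BY NAME: ONE pair `(K, c)` such that
for EVERY `m` (`n = m + 1`), all fine points `x x′` and colours `κ κ′`,
`|sandP n (Ga n a) (multM n (2a∕n⁸) 2) x x′ (inl κ) (inl κ′)| ≤ (n²)⁻¹·K·e^{−(c∕n)·|x − x′|₁}`.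
PROOF: `sandP = HRp ∘ (Qp ∘ Gp)`; the ff entry is a sum over the coarse columns `w = n•y₀` (the `𝒬`-rows vanish off `n•ℤ⁴`, `comp_Qp_Gp_inr_inl`) of
(the `ℋ_R` column `|HRp (x; n•y₀)| ≤ n⁻⁵·C₄·e^{−κ′‖⌊x∕n⌋ − y₀‖∞}`, `RestLegEnvelopes.abs_NlegRoad_inl_inr_coarse_le` via `NlegK_inl_inr_eq_HRp`) × (the contour
sum of the fine leg's column, `≤ n³·KQ·e^{−(δ∕(2n))‖x′ − n•y₀‖∞}`, §2); with `c₀ = min (κ′∕4) (δ∕8)` the product is `≤ n⁻²·4C₄KQ·e^{2c₀}·e^{−(c₀∕(2n))|x − x′|₁}·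
e^{−(c₀∕2)|⌊x∕n⌋ − y₀|₁}` (`|x − x′|₁ ≤ n|⌊x∕n⌋ − y₀|₁ + 4n + |x′ − n•y₀|₁`), and `Σ_{y₀} e^{−(c₀∕2)|⌊x∕n⌋ − y₀|₁} = Zl 4 (c₀∕2)`. -/
theorem exists_sandP_ff_le (h12 : B5.Prop12Printed (fam nOf hn1 MOf a ha)) (h126 : B5.Kernel126_127Printed (kfam nOf MOf)) :
    ∃ K c : ℝ, 0 < c ∧ 0 ≤ K ∧ ∀ (m : ℕ) (x x' : Fin 4 → ℤ) (κ κ' : Fin 4),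
      |sandP (m + 1) (Ga (m + 1) a) (multM (m + 1) (2 * a / ((m + 1 : ℕ) : ℝ) ^ 8) 2) x x' (Sum.inl κ) (Sum.inl κ')|
        ≤ ((((m + 1 : ℕ) : ℝ)) ^ 2)⁻¹ * K * Real.exp (-(c / ((m + 1 : ℕ) : ℝ)) * l1 (x - x')) := by
  obtain ⟨KQ, δ, hδ, hKQ, hQ⟩ := exists_contourSum_Ga_le ha h12 h126
  -- the constants of the `ℋ_R` column (`RestLegEnvelopes`)
  set κ₁ : ℝ := kappa163 (3 + 1) / (3 + 1) with hκ₁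
  set C₄ : ℝ := MG163 (3 + 1) * periodConst (kappa163 (3 + 1)) 3 with hC₄
  have hκ₁pos : 0 < κ₁ := by rw [hκ₁]; have := kappa163_pos (3 + 1); positivity
  set c₀ : ℝ := min (κ₁ / 4) (δ / 8) with hc₀
  have hc₀pos : 0 < c₀ := lt_min (by positivity) (by positivity)
  have hc₀κ : c₀ ≤ κ₁ / 4 := min_le_left _ _
  have hc₀δ : c₀ ≤ δ / 8 := min_le_right _ _
  -- `C₄ ≥ 0`, read off the `ℋ_R` bound at a coarse column
  have hC₄nn : 0 ≤ C₄ := by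
    have h := abs_NlegRoad_inl_inr_coarse_le 0 ha h12 h126 0 0 0 0
    have h1 : (0 : ℝ) ≤ ((((0 + 1 : ℕ) : ℝ)) ^ (3 + 2))⁻¹ * (MG163 (3 + 1) * periodConst (kappa163 (3 + 1)) 3) :=
      (mul_nonneg_iff_of_pos_right (Real.exp_pos _)).1 ((abs_nonneg _).trans h)
    simpa using h1
  refine ⟨4 * C₄ * KQ * Real.exp (2 * c₀) * Zl 4 (c₀ / 2), c₀ / 2, half_pos hc₀pos,
    by have := Zl_pos (D := 4) (half_pos hc₀pos); positivity, fun m x x' κ κ' => ?_⟩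
  have hn1 : 1 ≤ m + 1 := Nat.le_add_left 1 m
  have hnpos : (0 : ℝ) < ((m + 1 : ℕ) : ℝ) := by exact_mod_cast Nat.succ_pos m
  have hn0 : ((m + 1 : ℕ) : ℝ) ≠ 0 := hnpos.ne'
  -- abbreviations
  set Gl : MKer 4 (Fin 4) := Ga (m + 1) a with hGl
  set Cm : MKer 4 (Fin 4) := multM (m + 1) (2 * a / ((m + 1 : ℕ) : ℝ) ^ 8) 2 with hCm
  set g : (Fin 4 → ℤ) → ℝ := fun w =>
    ∑ m' : Fin 4, HRp (m + 1) Gl Cm x w (Sum.inl κ) (Sum.inr m') * comp (Qp (m + 1)) (Gp Gl) w x' (Sum.inr m') (Sum.inl κ') with hg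
  -- Step 1: the ff entry is `∑' w, g w`
  have e1 : sandP (m + 1) Gl Cm x x' (Sum.inl κ) (Sum.inl κ') = ∑' w, g w := by
    show (∑' w, ∑ f : Fib 3, HRp (m + 1) Gl Cm x w (Sum.inl κ) f * comp (Qp (m + 1)) (Gp Gl) w x' f (Sum.inl κ')) = _
    refine tsum_congr fun w => ?_
    rw [Fintype.sum_sum_type]
    simp only [HRp_inl_inl, zero_mul, Finset.sum_const_zero, zero_add, hg]
  -- Step 2: `g` lives on the sublattice
  have hsupp : Function.support g ⊆ Set.range fun y : Fin 4 → ℤ => (((m + 1 : ℕ) : ℤ)) • y := by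
    intro w hw
    by_cases hpw : Torus.proj (m + 1) w = 0
    · exact ⟨quo (m + 1) w, (eq_zsmul_quo_of_proj (N := m + 1) hpw).symm⟩
    · exfalso
      apply hw
      simp only [hg, comp_Qp_Gp_inr_inl, hpw, if_false, mul_zero, Finset.sum_const_zero]
  have e2 : ∑' w, g w = ∑' y₀ : Fin 4 → ℤ, g ((((m + 1 : ℕ) : ℤ)) • y₀) :=
    (Function.Injective.tsum_eq (zsmul_injective (m + 1)) hsupp).symm
  -- Step 3: the pointwise majorant at a coarse column
  set K₀ : ℝ := ((((m + 1 : ℕ) : ℝ)) ^ 2)⁻¹ * (4 * C₄ * KQ * Real.exp (2 * c₀))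
      * Real.exp (-(c₀ / 2 / ((m + 1 : ℕ) : ℝ)) * l1 (x - x')) with hK₀
  have hK₀nn : 0 ≤ K₀ := by positivity
  have hmaj_pt : ∀ y₀ : Fin 4 → ℤ,
      ‖g ((((m + 1 : ℕ) : ℤ)) • y₀)‖ ≤ K₀ * Real.exp (-(c₀ / 2) * l1 (quotOf (m + 1) x - y₀)) := by
    intro y₀
    rw [Real.norm_eq_abs, hg]
    -- the two factors
    have hA : ∀ m' : Fin 4, |HRp (m + 1) Gl Cm x ((((m + 1 : ℕ) : ℤ)) • y₀) (Sum.inl κ) (Sum.inr m')|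
        ≤ ((((m + 1 : ℕ) : ℝ)) ^ (3 + 2))⁻¹ * C₄ * Real.exp (-(κ₁ * B4ContourShift.supNorm (quotOf (m + 1) x - y₀))) := by
      intro m'
      have h := abs_NlegRoad_inl_inr_coarse_le m ha h12 h126 x y₀ κ m'
      rw [NlegRoad, NlegK_inl_inr_eq_HRp] at h
      rw [hC₄, hκ₁]
      exact h
    have hB : ∀ m' : Fin 4, |comp (Qp (m + 1)) (Gp Gl) ((((m + 1 : ℕ) : ℤ)) • y₀) x' (Sum.inr m') (Sum.inl κ')|
        ≤ (((m + 1 : ℕ) : ℝ)) ^ 3 * KQ * Real.exp (-(δ / 2 / ((m + 1 : ℕ) : ℝ)) * (supNorm (d := 4) (x' - (((m + 1 : ℕ) : ℤ)) • y₀) : ℝ)) := by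
      intro m'
      rw [comp_Qp_Gp_inr_inl, if_pos (proj_zsmul (N := m + 1) y₀), quo_zsmul]
      exact hQ (m + 1) x' y₀ m' κ'
    -- the exponent bookkeeping
    set T : ℝ := l1 (quotOf (m + 1) x - y₀) with hT
    set U : ℝ := l1 (x' - (((m + 1 : ℕ) : ℤ)) • y₀) with hU
    have hT0 : 0 ≤ T := l1_nonneg _
    have hU0 : 0 ≤ U := l1_nonneg _
    have hS : T ≤ 4 * B4ContourShift.supNorm (quotOf (m + 1) x - y₀) := by
      have h := T4GaugeActionRatePair.l1_le_mul_supNorm (d := 3) (quotOf (m + 1) x - y₀)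
      have e : ((3 : ℕ) : ℝ) + 1 = 4 := by norm_num
      rw [e] at h
      exact h
    have hP : U ≤ 4 * (supNorm (d := 4) (x' - (((m + 1 : ℕ) : ℤ)) • y₀) : ℝ) := l1_le_four_mul_supNormP _
    -- `|x − x′|₁ ≤ n·T + 4n + U`
    have htri : l1 (x - x') ≤ ((m + 1 : ℕ) : ℝ) * T + ((m + 1 : ℕ) : ℝ) * 4 + U := by
      have h1 := l1_sub_triangle x ((((m + 1 : ℕ) : ℤ)) • y₀) x'
      have hq : quo (m + 1) (x - (((m + 1 : ℕ) : ℤ)) • y₀) = quotOf (m + 1) x - y₀ := by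
        have h := quo_add_zsmul (N := m + 1) x (-y₀)
        rw [smul_neg, ← sub_eq_add_neg, ← sub_eq_add_neg] at h
        exact h
      have h2 : l1 (x - (((m + 1 : ℕ) : ℤ)) • y₀) ≤ ((m + 1 : ℕ) : ℝ) * T + ((m + 1 : ℕ) : ℝ) * (3 + 1) := by
        have h := l1_le_l1_quo (N := m + 1) (d := 3) (x - (((m + 1 : ℕ) : ℤ)) • y₀)
        rw [hq] at h
        exact_mod_cast h
      have h3 : l1 ((((m + 1 : ℕ) : ℤ)) • y₀ - x') = U := by rw [hU, l1_sub_symm]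
      linarith
    have hexp : Real.exp (-(κ₁ * B4ContourShift.supNorm (quotOf (m + 1) x - y₀)))
          * Real.exp (-(δ / 2 / ((m + 1 : ℕ) : ℝ)) * (supNorm (d := 4) (x' - (((m + 1 : ℕ) : ℤ)) • y₀) : ℝ))
        ≤ Real.exp (2 * c₀) * Real.exp (-(c₀ / 2 / ((m + 1 : ℕ) : ℝ)) * l1 (x - x')) * Real.exp (-(c₀ / 2) * T) := by
      rw [← Real.exp_add, ← Real.exp_add, ← Real.exp_add]
      apply Real.exp_le_exp.2
      -- `κ₁·S ≥ c₀·T` and `(δ∕2∕n)·P ≥ (c₀∕n)·U`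
      have i1 : c₀ * T ≤ κ₁ * B4ContourShift.supNorm (quotOf (m + 1) x - y₀) := by
        have hS0 : 0 ≤ B4ContourShift.supNorm (quotOf (m + 1) x - y₀) := by linarith
        have h1 : c₀ * T ≤ c₀ * (4 * B4ContourShift.supNorm (quotOf (m + 1) x - y₀)) := mul_le_mul_of_nonneg_left hS (le_of_lt hc₀pos)
        have h2 : c₀ * 4 ≤ κ₁ := by linarith
        nlinarith
      have i2 : c₀ / ((m + 1 : ℕ) : ℝ) * U
          ≤ δ / 2 / ((m + 1 : ℕ) : ℝ) * (supNorm (d := 4) (x' - (((m + 1 : ℕ) : ℤ)) • y₀) : ℝ) := by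
        rw [div_mul_eq_mul_div, div_mul_eq_mul_div, div_le_div_iff_of_pos_right hnpos]
        have := mul_le_mul_of_nonneg_left hP (le_of_lt hc₀pos)
        nlinarith [show (0:ℝ) ≤ (supNorm (d := 4) (x' - (((m + 1 : ℕ) : ℤ)) • y₀) : ℝ) from by positivity]
      -- `(c₀∕2∕n)|x − x′| ≤ (c₀∕2)T + 2c₀ + (c₀∕(2n))U`
      have i3 : c₀ / 2 / ((m + 1 : ℕ) : ℝ) * l1 (x - x') ≤ c₀ / 2 * T + 2 * c₀ + c₀ / 2 / ((m + 1 : ℕ) : ℝ) * U := by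
        have h := mul_le_mul_of_nonneg_left htri (show 0 ≤ c₀ / 2 / ((m + 1 : ℕ) : ℝ) by positivity)
        have e : c₀ / 2 / ((m + 1 : ℕ) : ℝ) * (((m + 1 : ℕ) : ℝ) * T + ((m + 1 : ℕ) : ℝ) * 4 + U)
            = c₀ / 2 * T + 2 * c₀ + c₀ / 2 / ((m + 1 : ℕ) : ℝ) * U := by field_simp; ring
        linarith
      have i4 : c₀ / 2 / ((m + 1 : ℕ) : ℝ) * U ≤ c₀ / ((m + 1 : ℕ) : ℝ) * U := by
        have : c₀ / 2 / ((m + 1 : ℕ) : ℝ) ≤ c₀ / ((m + 1 : ℕ) : ℝ) := by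
          rw [div_div, div_le_div_iff_of_pos_left hc₀pos (by positivity) hnpos]; linarith
        exact mul_le_mul_of_nonneg_right this hU0
      nlinarith
    -- assemble
    have hn5 : ((((m + 1 : ℕ) : ℝ)) ^ (3 + 2))⁻¹ * (((m + 1 : ℕ) : ℝ)) ^ 3 = ((((m + 1 : ℕ) : ℝ)) ^ 2)⁻¹ := by
      field_simp
    calc |∑ m' : Fin 4, HRp (m + 1) Gl Cm x ((((m + 1 : ℕ) : ℤ)) • y₀) (Sum.inl κ) (Sum.inr m')
            * comp (Qp (m + 1)) (Gp Gl) ((((m + 1 : ℕ) : ℤ)) • y₀) x' (Sum.inr m') (Sum.inl κ')|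
        ≤ ∑ m' : Fin 4, |HRp (m + 1) Gl Cm x ((((m + 1 : ℕ) : ℤ)) • y₀) (Sum.inl κ) (Sum.inr m')|
            * |comp (Qp (m + 1)) (Gp Gl) ((((m + 1 : ℕ) : ℤ)) • y₀) x' (Sum.inr m') (Sum.inl κ')| := by
          refine (Finset.abs_sum_le_sum_abs _ _).trans (le_of_eq (Finset.sum_congr rfl fun m' _ => abs_mul _ _))
      _ ≤ ∑ _m' : Fin 4, (((((m + 1 : ℕ) : ℝ)) ^ (3 + 2))⁻¹ * C₄ * Real.exp (-(κ₁ * B4ContourShift.supNorm (quotOf (m + 1) x - y₀))))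
            * ((((m + 1 : ℕ) : ℝ)) ^ 3 * KQ * Real.exp (-(δ / 2 / ((m + 1 : ℕ) : ℝ)) * (supNorm (d := 4) (x' - (((m + 1 : ℕ) : ℤ)) • y₀) : ℝ))) :=
          Finset.sum_le_sum fun m' _ => mul_le_mul (hA m') (hB m') (abs_nonneg _) (by positivity)
      _ = 4 * (((((m + 1 : ℕ) : ℝ) ^ (3 + 2))⁻¹ * ((m + 1 : ℕ) : ℝ) ^ 3) * (C₄ * KQ)) * (Real.exp (-(κ₁ * B4ContourShift.supNorm (quotOf (m + 1) x - y₀))) * Real.exp (-(δ / 2 / ((m + 1 : ℕ) : ℝ)) * (supNorm (d := 4) (x' - ((m + 1 : ℕ) : ℤ) • y₀) : ℝ))) := by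
          rw [Finset.sum_const, Finset.card_univ, Fintype.card_fin, nsmul_eq_mul]; push_cast; ring
      _ ≤ 4 * (((((m + 1 : ℕ) : ℝ) ^ (3 + 2))⁻¹ * ((m + 1 : ℕ) : ℝ) ^ 3) * (C₄ * KQ)) * (Real.exp (2 * c₀) * Real.exp (-(c₀ / 2 / ((m + 1 : ℕ) : ℝ)) * l1 (x - x')) * Real.exp (-(c₀ / 2) * T)) :=
          mul_le_mul_of_nonneg_left hexp (by positivity)
      _ = K₀ * Real.exp (-(c₀ / 2) * T) := by rw [hK₀, ← hn5]; ring
  -- Step 4: sum the majorant over the coarse columns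
  have hsum : Summable fun y₀ : Fin 4 → ℤ => K₀ * Real.exp (-(c₀ / 2) * l1 (quotOf (m + 1) x - y₀)) :=
    (summable_exp_shift (half_pos hc₀pos) (quotOf (m + 1) x)).mul_left K₀
  have hb := tsum_of_norm_bounded hsum.hasSum hmaj_pt
  rw [Real.norm_eq_abs] at hb
  rw [hGl, hCm] at e1
  rw [e1, e2]
  refine hb.trans (le_of_eq ?_)
  rw [tsum_mul_left, tsum_exp_shift, hK₀]
  ring

/-- [folklore] **«SAND-ENV» IN BLOCK CURRENCY**: modulo `h12 ∧ h126` there are n-free `K, c > 0` with, for every `m` (`n = m+1`),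
`Decays (blk (sandP n (Ga n a) (multM n (2a∕n⁸) 2)) true true) (K∕n²) (c∕n)` — the `B`-leg letter of `RestKernelWords.absMoment₂_crossWord_NlegRoad` with
n-EXPLICIT constants (the `(−½)•` of «NLEG-HESS-SPLIT» scales `K` by `½`, `TameKernelCalculus`∕`spr_smul'` style). -/
theorem exists_decays_blk_sandP_road (h12 : B5.Prop12Printed (fam nOf hn1 MOf a ha)) (h126 : B5.Kernel126_127Printed (kfam nOf MOf)) :
    ∃ K c : ℝ, 0 < c ∧ 0 ≤ K ∧ ∀ m : ℕ,
      Decays (blk (sandP (m + 1) (Ga (m + 1) a) (multM (m + 1) (2 * a / ((m + 1 : ℕ) : ℝ) ^ 8) 2)) true true)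
        (K / (((m + 1 : ℕ) : ℝ)) ^ 2) (c / ((m + 1 : ℕ) : ℝ)) := by
  obtain ⟨K, c, hc, hK, h⟩ := exists_sandP_ff_le ha h12 h126
  refine ⟨K, c, hc, hK, fun m x x' κ κ' => ?_⟩
  show |sandP (m + 1) (Ga (m + 1) a) (multM (m + 1) (2 * a / ((m + 1 : ℕ) : ℝ) ^ 8) 2) x x' (Sum.inl κ) (Sum.inl κ')| ≤ _
  refine (h m x x' κ κ').trans (le_of_eq ?_)
  rw [div_eq_mul_inv K]
  ring

end Sandwich

end Summit.QuantumFields.BalabanUV.Beta.D1BFx.RestLegSandwich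

end
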